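import Literature.MathematicalPhysics.QuantumLattice.GrassmannPolchinskiEquation
import Literature.MathematicalPhysics.QuantumLattice.GrassmannGaussConvKernelBound
import Literature.MathematicalPhysics.QuantumLattice.GrassmannPresentedTensor
import Mathlib.Analysis.Calculus.MeanValue
import HarnessLib

/-!
# The response of the two-leg kernels of the effective action to a change of COVARIANCE, read at a fixed label string:
# Polchinski interpolation, the tree (pairing) term as a PRODUCT of two-leg kernels, the loop term by the sup of `Ċ`

Topic `MathematicalPhysics/QuantumLattice`; sequel of `GrassmannPolchinskiEquation.lean` (Salmhofer's RGE
`∂_t 𝒱_t = Δ_{Ċ}𝒱_t − ½(δ𝒱_t/δψ, Ċ δ𝒱_t/δψ) − [·]_∅`, `hasCoeffDerivAt_effAction_flow`) and of `GrassmannGaussConvKernelBound.lean`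
(`kernel_grassmannLaplacian`).  For two covariances `C₀, C₁` on a finite label set and the straight path `C_t = C₀ + t(C₁ − C₀)` the RGE
is integrated (mean-value form) against a fixed linear functional — typically "the two-leg kernel at one label string `X`":

* **`kernel_two_mul_of_mem_evenOdd_one`** — for ODD `x, y`: `kernel (x·y) 2 X = ½(x₁(X₀) y₁(X₁) − x₁(X₁) y₁(X₀))`, `x₁ = kernel x 1`;
* **`kernel_two_grassmannDerivPairing`** — for EVEN `a, b` the two-leg kernel of Salmhofer's bilinear term is a PRODUCT of two-leg kernels:
  `kernel (δa/δψ, C δb/δψ) 2 X = 2 Σ_{A,B} C(A,B)·(a₂(A,X₀) b₂(B,X₁) − a₂(A,X₁) b₂(B,X₀))` (`a₂ = kernel a 2`) — the reducible ("tree",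
  one-particle-reducible) part of the response carries NO sum over internal positions beyond the contraction with `C`: read at a point it
  is a product, not a convolution;
* **`norm_kernel_two_grassmannLaplacian_le`**, `…_le_of_pairing` — the loop term `kernel (Δ_C W) 2 X = 6 Σ_{A,B} C(A,B) W₄(X,B,A)` costs
  the ENTRY sum `Σ|C(A,B)|` (for a covariance pairing `A` only with `τ A`: `Σ_A |C(A,τA)|`) times a sup of the four-leg kernel — no
  position moment of `C`;
* **`hasDerivAt_apply_effAction_linePath`** — along `C_t`, every `𝕜`-linear functional `Φ` with `Φ 1 = 0` of `𝒱_t = effAction C_t V`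
  has derivative `Φ(Δ_{C₁−C₀}𝒱_t) − ½ Φ((δ𝒱_t/δψ, (C₁−C₀) δ𝒱_t/δψ))` (the constant-part term of the RGE drops);
* **`norm_apply_effAction_sub_le_of_linePath`** — MEAN-VALUE FORM: if that derivative is bounded by `B` on `t ∈ [0,1]` (and `Z_t ≠ 0`
  there) then `‖Φ(effAction C₁ V) − Φ(effAction C₀ V)‖ ≤ B`.

This is the generic layer of the "covariance-response door" for two-leg outputs of a fermionic single-scale step (cell gate-hubbard-kl,
K3 ENGINE `stub_twoLeg_scale0` (E3c)₀: the frame-Lipschitz response of the scale-`0` self-energy between two counterterm frames `K, K′`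
whose RESUMMED covariances differ only on the ultraviolet cutoff shell; the model instance reads `Φ` = self-energy at the reading point,
where the tree term is `Σ_t(k)²·Ċ(k)` and the loop term is `≤ 6·Σ|Ċ|·sup|𝒱_{t,4}|`).  Generic finite Grassmann algebra: nothing about
any model is asserted.  Everything is proved; no definition, no named fact.

## Sources

M. Salmhofer, Commun. Math. Phys. 194 (1998) 249–295, §3.1 Prop. 1 (the RGE) and §4.1 (kernel estimates of the bilinear term)
[`Salmhofer1998`]; M. Salmhofer, *Renormalization: An Introduction* (Springer 1999), §4.3 (4.86)–(4.100) [`Salmhofer1999`];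
J. Polchinski, Nucl. Phys. B 231 (1984) 269 (the flow equation) — cited through Salmhofer.
-/

noncomputable section

namespace Literature.MathematicalPhysics.QuantumLattice

open GrassmannAlgebra Finset

/-! ## §1 Two-leg kernels of a product of two odd elements and of Salmhofer's pairing -/

section PairingKernel

variable (R : Type*) [CommRing R] [Algebra ℚ R] {Γ : Type*} [Fintype Γ]

omit [Fintype Γ] in
/-- The one-leg kernel is the constant part of one derivative: `kernel x 1 (Q) = [∂_Q x]_∅`. [cite: Salmhofer1999, §4.3 (4.95)] -/
theorem kernel_one_eq_constPart_grassmannDeriv (x : GrassmannAlgebra R Γ) (Q : Γ) :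
    kernel R x 1 ![Q] = constPart R (grassmannDeriv R Q x) := by
  rw [kernel_def, iterDeriv_succ_apply, iterDeriv_zero_apply, Nat.factorial_one, Nat.cast_one, inv_one, one_smul, one_mul]
  rfl

/-- **The two-leg kernel of a product of two ODD elements**: `kernel (x·y) 2 (X₀,X₁) = ½·([∂_{X₀}x]_∅[∂_{X₁}y]_∅ − [∂_{X₁}x]_∅[∂_{X₀}y]_∅)`
(graded Leibniz; the terms `(∂∂x)·y`, `x·(∂∂y)` have odd cofactors and no constant part). [cite: Salmhofer1999, §4.3 (4.95)] -/
theorem kernel_two_mul_of_mem_evenOdd_one {x y : GrassmannAlgebra R Γ} (hx : x ∈ evenOdd R 1) (hy : y ∈ evenOdd R 1)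
    (X : Fin 2 → Γ) :
    kernel R (x * y) 2 X = ((1 / 2 : ℚ) • (1 : R)) *
      (kernel R x 1 ![X 0] * kernel R y 1 ![X 1] - kernel R x 1 ![X 1] * kernel R y 1 ![X 0]) := by
  -- the two derivatives of the product
  have h0 : grassmannDeriv R (X 0) (x * y) = grassmannDeriv R (X 0) x * y - x * grassmannDeriv R (X 0) y := by
    rw [grassmannDeriv_mul, CliffordAlgebra.involute_eq_of_mem_odd hx, neg_mul, ← sub_eq_add_neg]
  have hxe : grassmannDeriv R (X 0) x ∈ evenOdd R 0 := by
    have h := grassmannDeriv_mem_evenOdd R (X 0) hx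
    rwa [show (1 : ZMod 2) + 1 = 0 from by decide] at h
  have h1 : grassmannDeriv R (X 1) (grassmannDeriv R (X 0) (x * y)) =
      grassmannDeriv R (X 1) (grassmannDeriv R (X 0) x) * y + grassmannDeriv R (X 0) x * grassmannDeriv R (X 1) y -
        (grassmannDeriv R (X 1) x * grassmannDeriv R (X 0) y - x * grassmannDeriv R (X 1) (grassmannDeriv R (X 0) y)) := by
    rw [h0, map_sub, grassmannDeriv_mul_of_mem_evenOdd_zero R (X 1) hxe, grassmannDeriv_mul,
      CliffordAlgebra.involute_eq_of_mem_odd hx, neg_mul, ← sub_eq_add_neg]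
  -- constant parts: odd cofactors contribute nothing
  have hy0 : constPart R y = 0 := constPart_eq_zero_of_mem_evenOdd_one R hy
  have hx0 : constPart R x = 0 := constPart_eq_zero_of_mem_evenOdd_one R hx
  rw [kernel_def, iterDeriv_succ_apply, iterDeriv_succ_apply, iterDeriv_zero_apply]
  simp only [Fin.succ_zero_eq_one]
  rw [h1, map_sub, map_add, map_sub, map_mul, map_mul, map_mul, map_mul, hy0, hx0, mul_zero, zero_mul, zero_add, sub_zero,
    kernel_one_eq_constPart_grassmannDeriv, kernel_one_eq_constPart_grassmannDeriv, kernel_one_eq_constPart_grassmannDeriv,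
    kernel_one_eq_constPart_grassmannDeriv, Nat.factorial_two, Nat.cast_ofNat, one_div]

omit [Fintype Γ] in
/-- The one-leg kernel of a derivative is twice the two-leg kernel with the derivative's label in front:
`kernel (∂_A a) 1 (Q) = 2·kernel a 2 (A,Q)`. [cite: Salmhofer1999, §4.3 (4.95)] -/
theorem kernel_one_grassmannDeriv (A : Γ) (a : GrassmannAlgebra R Γ) (Q : Γ) :
    kernel R (grassmannDeriv R A a) 1 ![Q] = 2 * kernel R a 2 ![A, Q] := by
  rw [kernel_grassmannDeriv]
  norm_num

omit [Fintype Γ] in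
/-- `(½·1)·2 = 1` in a `ℚ`-algebra (bookkeeping). [folklore] -/
private theorem half_smul_one_mul_two : ((1 / 2 : ℚ) • (1 : R)) * 2 = 1 := by
  have h2 : (2 : ℚ) • (1 : R) = 2 := by rw [← Algebra.algebraMap_eq_smul_one, map_ofNat]
  rw [← h2, smul_mul_smul_comm, one_mul]
  norm_num

omit [Fintype Γ] in
/-- `(½·1)·(2u·2v − 2u′·2v′) = 2(uv − u′v′)` in a `ℚ`-algebra (bookkeeping). [folklore] -/
private theorem half_smul_one_mul_pairs (u v u' v' : R) :
    ((1 / 2 : ℚ) • (1 : R)) * (2 * u * (2 * v) - 2 * u' * (2 * v')) = 2 * (u * v - u' * v') := by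
  calc ((1 / 2 : ℚ) • (1 : R)) * (2 * u * (2 * v) - 2 * u' * (2 * v'))
      = (((1 / 2 : ℚ) • (1 : R)) * 2) * (2 * (u * v - u' * v')) := by ring
    _ = 2 * (u * v - u' * v') := by rw [half_smul_one_mul_two, one_mul]

/-- **The two-leg kernel of Salmhofer's bilinear term is a product of two-leg kernels** (EVEN `a`, `b`):
`kernel (δa/δψ, C δb/δψ)_Γ 2 (X₀,X₁) = 2·Σ_{A,B} C(A,B)·(a₂(A,X₀)·b₂(B,X₁) − a₂(A,X₁)·b₂(B,X₀))`, `a₂ = kernel a 2`, `b₂ = kernel b 2`.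
Read at ONE string `X` the one-particle-reducible part of Polchinski's equation is a finite sum of products — no convolution over internal
positions. [cite: Salmhofer1998, §3.1 Prop. 1 (RGE); §4.1] -/
theorem kernel_two_grassmannDerivPairing (C : Matrix Γ Γ R) {a b : GrassmannAlgebra R Γ} (ha : a ∈ evenOdd R 0)
    (hb : b ∈ evenOdd R 0) (X : Fin 2 → Γ) :
    kernel R (grassmannDerivPairing R C a b) 2 X =
      2 * ∑ A, ∑ B, C A B * (kernel R a 2 ![A, X 0] * kernel R b 2 ![B, X 1] - kernel R a 2 ![A, X 1] * kernel R b 2 ![B, X 0]) := by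
  have hax : ∀ A, grassmannDeriv R A a ∈ evenOdd R 1 := fun A => by
    have h := grassmannDeriv_mem_evenOdd R A ha; rwa [zero_add] at h
  have hbx : ∀ B, grassmannDeriv R B b ∈ evenOdd R 1 := fun B => by
    have h := grassmannDeriv_mem_evenOdd R B hb; rwa [zero_add] at h
  rw [grassmannDerivPairing_apply, kernel_sum, mul_sum]
  refine sum_congr rfl fun A _ => ?_
  rw [kernel_sum, mul_sum]
  refine sum_congr rfl fun B _ => ?_
  rw [kernel_smul, kernel_two_mul_of_mem_evenOdd_one R (hax A) (hbx B), kernel_one_grassmannDeriv, kernel_one_grassmannDeriv,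
    kernel_one_grassmannDeriv, kernel_one_grassmannDeriv, half_smul_one_mul_pairs]
  ring

end PairingKernel

/-! ## §2 The loop term: `kernel (Δ_C W) 2 X` costs the entry sum of `C` and a sup of the four-leg kernel -/

section LoopKernel

variable {𝕜 : Type*} [RCLike 𝕜] {Γ : Type*} [Fintype Γ]

/-- `‖((3·4/2 : ℚ) • 1 : 𝕜)‖ = 6` (bookkeeping). [folklore] -/
private theorem norm_pairPositions_two : ‖(((((2 + 1) * (2 + 2) : ℕ) : ℚ) / 2) • (1 : 𝕜))‖ = 6 := by
  rw [show ((((2 + 1) * (2 + 2) : ℕ) : ℚ) / 2) = (6 : ℚ) by norm_num, Rat.smul_one_eq_cast, Rat.cast_ofNat]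
  exact RCLike.norm_ofNat 6

/-- **The loop term of the response at one string**: `‖kernel (Δ_C W) 2 X‖ ≤ 6·Σ_{A,B} ‖C(A,B)‖·‖kernel W 4 (X,B,A)‖`
(`kernel_grassmannLaplacian` at degree `2`: `(2+1)(2+2)/2 = 6` positions of the contracted pair). [cite: Salmhofer1999, §4.3.2 (4.86)] -/
theorem norm_kernel_two_grassmannLaplacian_le (C : Matrix Γ Γ 𝕜) (W : GrassmannAlgebra 𝕜 Γ) (X : Fin 2 → Γ) :
    ‖kernel 𝕜 (grassmannLaplacian 𝕜 C W) 2 X‖ ≤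
      6 * ∑ A, ∑ B, ‖C A B‖ * ‖kernel 𝕜 W 4 (Fin.snoc (Fin.snoc X B : Fin 3 → Γ) A)‖ := by
  rw [kernel_grassmannLaplacian, norm_mul, norm_pairPositions_two]
  gcongr
  refine (norm_sum_le _ _).trans (sum_le_sum fun A _ => (norm_sum_le _ _).trans (sum_le_sum fun B _ => ?_))
  rw [norm_mul]

/-- **Loop term for a covariance with a pairing map**: if `C(A,B) ≠ 0` only for `B = τ A` and the four-leg kernels at the strings
`(X, τA, A)` are bounded by `N`, then `‖kernel (Δ_C W) 2 X‖ ≤ 6·(Σ_A ‖C(A,τA)‖)·N` — the ENTRY sum of `C` (for a momentum-diagonal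
covariance: the `ℓ¹` norm of its symbol), never a position moment. [cite: Salmhofer1999, §4.3.2 (4.86)] -/
theorem norm_kernel_two_grassmannLaplacian_le_of_pairing (C : Matrix Γ Γ 𝕜) (τ : Γ → Γ) (hC : ∀ A B, B ≠ τ A → C A B = 0)
    (W : GrassmannAlgebra 𝕜 Γ) (X : Fin 2 → Γ) {N : ℝ}
    (hN : ∀ A, ‖kernel 𝕜 W 4 (Fin.snoc (Fin.snoc X (τ A) : Fin 3 → Γ) A)‖ ≤ N) :
    ‖kernel 𝕜 (grassmannLaplacian 𝕜 C W) 2 X‖ ≤ 6 * (∑ A, ‖C A (τ A)‖) * N := by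
  classical
  refine (norm_kernel_two_grassmannLaplacian_le C W X).trans ?_
  rw [mul_assoc, sum_mul]
  gcongr with A _
  rw [Finset.sum_eq_single (τ A) (fun B _ hB => by rw [hC A B hB, norm_zero, zero_mul]) (fun h => absurd (mem_univ _) h)]
  exact mul_le_mul_of_nonneg_left (hN A) (norm_nonneg _)

end LoopKernel

/-! ## §3 The straight covariance path: derivative of a linear functional of `𝒱_t` and the mean-value form -/

section LinePath

variable {Γ : Type*} [LinearOrder Γ] [Fintype Γ]

omit [LinearOrder Γ] [Fintype Γ] in
/-- The straight path `C_t = C₀ + t·(C₁ − C₀)` between two covariances (real parameter, complex entries): entrywise derivative `C₁ − C₀`. [folklore] -/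
private theorem hasDerivAt_linePath_apply (C₀ C₁ : Matrix Γ Γ ℂ) (t : ℝ) (X Y : Γ) :
    HasDerivAt (fun r : ℝ => (C₀ + ((r : ℂ)) • (C₁ - C₀)) X Y) ((C₁ - C₀) X Y) t := by
  simp only [Matrix.add_apply, Matrix.smul_apply, smul_eq_mul]
  have h : HasDerivAt (fun r : ℝ => (r : ℂ)) 1 t := Complex.ofRealCLM.hasDerivAt
  have h2 := (h.mul_const ((C₁ - C₀) X Y)).const_add (C₀ X Y)
  rwa [one_mul] at h2

/-- **Derivative of a linear functional of the effective action along the straight covariance path.**  For `C_t = C₀ + t(C₁ − C₀)`,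
`V` even without constant part, `Z_t ≠ 0`, and a `ℂ`-linear `Φ` with `Φ 1 = 0`:
`d/dt Φ(𝒱_t) = Φ(Δ_{C₁−C₀} 𝒱_t) − ½·Φ((δ𝒱_t/δψ, (C₁−C₀) δ𝒱_t/δψ))` (the RGE, `hasCoeffDerivAt_effAction_flow`; its constant-part term is
killed by `Φ 1 = 0`). [cite: Salmhofer1998, §3.1 Prop. 1 (RGE)] -/
theorem hasDerivAt_apply_effAction_linePath (C₀ C₁ : Matrix Γ Γ ℂ) {V : GrassmannAlgebra ℂ Γ} (hV0 : constPart ℂ V = 0)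
    (hVe : V ∈ evenOdd ℂ 0) {t : ℝ} (hZ : effPartitionFn ℂ (C₀ + ((t : ℂ)) • (C₁ - C₀)) V ≠ 0)
    (Φ : GrassmannAlgebra ℂ Γ →ₗ[ℂ] ℂ) (hΦ : Φ 1 = 0) :
    HasDerivAt (fun r : ℝ => Φ (effAction ℂ (C₀ + ((r : ℂ)) • (C₁ - C₀)) V))
      (Φ (grassmannLaplacian ℂ (C₁ - C₀) (effAction ℂ (C₀ + ((t : ℂ)) • (C₁ - C₀)) V)) -
        (2 : ℂ)⁻¹ * Φ (grassmannDerivPairing ℂ (C₁ - C₀) (effAction ℂ (C₀ + ((t : ℂ)) • (C₁ - C₀)) V)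
          (effAction ℂ (C₀ + ((t : ℂ)) • (C₁ - C₀)) V))) t := by
  have h := ((hasCoeffDerivAt_effAction_flow (𝕂 := ℝ) (𝕜 := ℂ) (C := fun r : ℝ => C₀ + ((r : ℂ)) • (C₁ - C₀)) (C' := C₁ - C₀)
    (t := t) (hasDerivAt_linePath_apply C₀ C₁ t) hV0 hVe hZ).1).apply Φ
  simp only [map_sub, map_smul, smul_eq_mul, hΦ, mul_zero, sub_zero] at h
  exact h

/-- **MEAN-VALUE FORM of the covariance response.**  Along `C_t = C₀ + t(C₁ − C₀)`, `t ∈ [0,1]`, with `Z_t ≠ 0` and a `ℂ`-linear `Φ`,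
`Φ 1 = 0`: if `‖Φ(Δ_{C₁−C₀}𝒱_t) − ½Φ((δ𝒱_t/δψ, (C₁−C₀) δ𝒱_t/δψ))‖ ≤ B` for every `t ∈ [0,1]`, then
`‖Φ(effAction C₁ V) − Φ(effAction C₀ V)‖ ≤ B`. [cite: Salmhofer1998, §3.1 Prop. 1 (RGE); §4.1] -/
theorem norm_apply_effAction_sub_le_of_linePath (C₀ C₁ : Matrix Γ Γ ℂ) {V : GrassmannAlgebra ℂ Γ} (hV0 : constPart ℂ V = 0)
    (hVe : V ∈ evenOdd ℂ 0) (hZ : ∀ t ∈ Set.Icc (0 : ℝ) 1, effPartitionFn ℂ (C₀ + ((t : ℂ)) • (C₁ - C₀)) V ≠ 0)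
    (Φ : GrassmannAlgebra ℂ Γ →ₗ[ℂ] ℂ) (hΦ : Φ 1 = 0) {B : ℝ}
    (hB : ∀ t ∈ Set.Icc (0 : ℝ) 1,
      ‖Φ (grassmannLaplacian ℂ (C₁ - C₀) (effAction ℂ (C₀ + ((t : ℂ)) • (C₁ - C₀)) V)) -
        (2 : ℂ)⁻¹ * Φ (grassmannDerivPairing ℂ (C₁ - C₀) (effAction ℂ (C₀ + ((t : ℂ)) • (C₁ - C₀)) V)
          (effAction ℂ (C₀ + ((t : ℂ)) • (C₁ - C₀)) V))‖ ≤ B) :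
    ‖Φ (effAction ℂ C₁ V) - Φ (effAction ℂ C₀ V)‖ ≤ B := by
  set f : ℝ → ℂ := fun r => Φ (effAction ℂ (C₀ + ((r : ℂ)) • (C₁ - C₀)) V) with hf
  have hderiv : ∀ t ∈ Set.Icc (0 : ℝ) 1, HasDerivWithinAt f
      (Φ (grassmannLaplacian ℂ (C₁ - C₀) (effAction ℂ (C₀ + ((t : ℂ)) • (C₁ - C₀)) V)) -
        (2 : ℂ)⁻¹ * Φ (grassmannDerivPairing ℂ (C₁ - C₀) (effAction ℂ (C₀ + ((t : ℂ)) • (C₁ - C₀)) V)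
          (effAction ℂ (C₀ + ((t : ℂ)) • (C₁ - C₀)) V))) (Set.Icc (0 : ℝ) 1) t :=
    fun t ht => (hasDerivAt_apply_effAction_linePath C₀ C₁ hV0 hVe (hZ t ht) Φ hΦ).hasDerivWithinAt
  have h := Convex.norm_image_sub_le_of_norm_hasDerivWithin_le hderiv hB (convex_Icc (0 : ℝ) 1)
    (Set.left_mem_Icc.2 zero_le_one) (Set.right_mem_Icc.2 zero_le_one)
  have h1 : f 1 = Φ (effAction ℂ C₁ V) := by simp [hf]
  have h0 : f 0 = Φ (effAction ℂ C₀ V) := by simp [hf]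
  simpa [h1, h0] using h

end LinePath

end Literature.MathematicalPhysics.QuantumLattice

end
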